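import Summits.HodgeConjecture.HodgeConjecture.Theorems.CyclicUnitaryPowersFermatAffineEigenfunctions
import Summits.HodgeConjecture.HodgeConjecture.Theorems.CyclicUnitaryPowersAffineCoordExtension
import Summits.HodgeConjecture.HodgeConjecture.Theorems.CyclicUnitaryPowersTopFormRatioGrowth
import Literature.AlgebraicGeometry.HodgeTheory.GriffithsResiduesPoleOrderOne
import Literature.AlgebraicGeometry.HodgeTheory.FermatEigenspaceHodgeDecomposition
import Literature.AlgebraicGeometry.HodgeTheory.FermatAffineChart
import Literature.AlgebraicGeometry.HodgeTheory.HolomorphicTopFormClassesBijective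
import Literature.Geometry.Kaehler.HolomorphicTopFormsLine

/-!
# Holomorphic 2-forms on the Fermat surface with a character of weight ≥ 2 vanish (programme PG-FERMAT, assembly F2/F4a)

Prover seat `hodge-nonav-prover-Bx` (g10), cell `hodge-nonav`, for crux K1-A (stmt-HodgeConjecture-19544): the geometric-genus
stub `Arapura2012_hypersurface_geometricGenus` is consumed by K1 only through `h^{2,0}(X²_p) ≤ C(p-1, 3)` for the Fermat surface
`X²_p` (`CyclicUnitaryPowersK1OfFermatGenusLe`). Shioda's (1.7): `H^{2,0}(X²_p) ∩ V(β) ≠ 0` only for the `C(p-1,3)` characters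
`β = (b₀, …, b₃)`, `1 ≤ bᵢ ≤ p - 1`, `Σ bᵢ = p`. This file proves the vanishing half on the tree's carriers, by the Liouville
argument of programme PG-FERMAT (memo `PROGRAMME-PG-FERMAT-Bx-g10.md`), assembling bricks F3 (`eqOn_zero_of_eigenfunction_of_growth`:
`μ_p³`-eigenfunctions of small growth on the affine Fermat surface vanish), F1b (`exists_differentiableOn_eqOn_image_affineCoord`),
F1c (`exists_bound_topFormRatio`) with the tree's residue forms (`residueForm_ne_zero`, `pullback_residueForm_symm`, `ratio_symm`):

* `eq_zero_of_fermat_eigenform` — **model level**: on a compact complex surface `M` embedded onto `V(Σ xᵢᵖ) ⊂ ℙ³` (`p ≥ 4`) with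
  holomorphic affine coordinates and holomorphic lifts `Φ_a` of the diagonal symmetries `a ∈ μ_p⁴`, a holomorphic-in-charts `2`-form
  `η` with `Φ_a^* η = χ_β(a) η` vanishes as soon as `p - 4 < Σ_{l ≠ i₀} ⟨β_l - 1⟩` for every `i₀` — on `M_{i₀} = {x_{i₀} ≠ 0}`,
  `η = f · Res(x_{i₀}^{p-4}Ω/F)` with `f`, read in the affine coordinates, a `μ_p³`-eigenfunction of exponents `⟨β_l - 1⟩` and growth
  `(1 + |y|)^{p-4}`, so `f = 0` by F3; and `M = ⋃ M_{i₀}`.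
* `fermat_eigenform_twoZero_eq_zero` — **Hodge-model level**: the same for smooth closed `(2,0)`-forms on the carrier of any Hodge
  model of `X²_p`, the symmetries acting by `HodgeModel.anMap A A (diagonalAut _ _)` (Serre GAGA §2 n°5); the hypothesis `hforms` of
  the tree's `fermatEigenspace_twoZero_eq_zero_of_eigenforms`.
* `fermatEigenspace_twoZero_eq_zero` — **class level**: `V(β) ∩ H^{2,0}(X²_p) = 0` for every such `β`; in particular
  (`fermatEigenspace_twoZero_eq_zero_of_two_le_level`) for every admissible `β` with `Σ ⟨βᵢ⟩ ≥ 2p`, and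
  (`fermatEigenspace_twoZero_eq_zero_of_exists_eq_zero`) for every `β` with `Σ βᵢ = 0` having a zero component.

Sorry-free; no definition, no named fact; helper (`--supports stmt-HodgeConjecture-19544`); nothing here says HC ∕ HC_AV is proved.
-/

noncomputable section

set_option linter.dupNamespace false

open scoped Manifold ContDiff Topology LinearAlgebra.Projectivization
open Set Filter Function Projectivization

namespace Summit.HodgeConjecture.HodgeConjecture.Theorems.CyclicUnitaryPowersFermatEigenformVanishing

open Literature.AlgebraicGeometry.HodgeTheory Literature.AlgebraicGeometry.Motives Literature.NumberTheory.Transcendental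
  Literature.Geometry.Kaehler Literature.AlgebraicTopology.SingularHomology
  Summit.HodgeConjecture.HodgeConjecture.Theorems.CyclicUnitaryPowersFermatAffineEigenfunctions
  Summit.HodgeConjecture.HodgeConjecture.Theorems.CyclicUnitaryPowersAffineCoordExtension
  Summit.HodgeConjecture.HodgeConjecture.Theorems.CyclicUnitaryPowersTopFormRatioGrowth

/-! ### Arithmetic of the exponents -/

/-- `ζ ^ n = ζ ^ (n % p)` for a `p`-th root of unity `ζ`. [folklore] -/
theorem pow_eq_pow_mod_of_pow_eq_one {ζ : ℂ} {p : ℕ} (hζ : ζ ^ p = 1) (n : ℕ) : ζ ^ n = ζ ^ (n % p) := by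
  conv_lhs => rw [← Nat.div_add_mod n p, pow_add, pow_mul, hζ, one_pow, one_mul]

/-- For `ζᵖ = 1` and `b ∈ ℤ/p` (`p ≥ 2`): `ζ^{⟨b⟩} = ζ^{⟨b - 1⟩} · ζ`. [folklore] -/
theorem pow_val_eq_pow_val_sub_one_mul {p : ℕ} [Fact (1 < p)] {ζ : ℂ} (hζ : ζ ^ p = 1) (b : ZMod p) :
    ζ ^ b.val = ζ ^ (b - 1).val * ζ := by
  have hmod : (b - 1).val + 1 ≡ b.val [MOD p] := by
    have h := ZMod.val_add (b - 1) 1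
    rw [sub_add_cancel, ZMod.val_one] at h
    rw [Nat.ModEq, ← h, Nat.mod_eq_of_lt (ZMod.val_lt b)]
  rw [← pow_succ, pow_eq_pow_mod_of_pow_eq_one hζ ((b - 1).val + 1), pow_eq_pow_mod_of_pow_eq_one hζ b.val, hmod]

/-! ### Model level -/

section Model

variable {E : Type*} [NormedAddCommGroup E] [NormedSpace ℂ E] [FiniteDimensional ℂ E]
  {M : Type*} [TopologicalSpace M] [ChartedSpace E M] [IsManifold 𝓘(ℂ, E) ω M] [IsManifold 𝓘(ℝ, E) ∞ M]

/-- **Holomorphic `2`-forms with a diagonal character of weight ≥ 2 vanish on a model of the Fermat surface.** Let `M` be a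
compact complex surface (`dim_ℂ E = 2`) with a topological embedding `ψ` ONTO `V(Σᵢ xᵢᵖ) ⊂ ℙ(ℂ⁴)`, `p ≥ 4`, whose affine
coordinates are holomorphic, and for each `a ∈ μ_p⁴` a holomorphic `Φ_a : M → M` over `[z] ↦ [a • z]`. If a `2`-form `η`
holomorphic in charts satisfies `Φ_a^* η = χ_β(a) • η` (`χ_β(a) = ∏ aᵢ^{⟨βᵢ⟩}`) for all `a`, and for every `i₀` the exponents
`c_l = ⟨β_l - 1⟩`, `l ≠ i₀`, have `Σ c_l > p - 4`, then `η = 0`. Proof, on each `M_{i₀}`: `η = f · ρ`, `ρ = ψ^* Res(x_{i₀}^{p-4}Ω/F)`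
nowhere zero there (`residueForm_ne_zero`), `f` holomorphic (`mdifferentiableAt_topFormRatio_of_isHolomorphicInCharts`); since
`Φ_a^* ρ = (∏ aᵢ) a_{i₀}^{p-4} ρ` (`pullback_residueForm_symm`), `f ∘ Φ_a · (∏ aᵢ) a_{i₀}^{p-4} = χ_β(a) f` (`ratio_symm`); read in
the affine coordinates `u_{i₀}` (F1b: locally a restriction of holomorphic functions of `ℂ³`; F1c: growth `(1 + |y|)^{p-4}`) this
is a `μ_p³`-eigenfunction on `{Σ y_lᵖ = -1}` with exponents `c_l`, hence zero by brick F3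
(`eqOn_zero_of_eigenfunction_of_growth`). [cite: Shioda1979HodgeFermat, §1 (1.7)] [cite: VoisinHodgeII2003, §6.1.3 and Cor. 6.12 (p = 1)] -/
theorem eq_zero_of_fermat_eigenform [CompactSpace M] (hdim : Module.finrank ℂ E = 2) {p : ℕ} (hp : 4 ≤ p)
    {ψ : M → ℙ ℂ (Fin 4 → ℂ)} (hψ : Topology.IsEmbedding ψ)
    (hrange : Set.range ψ = projZeroLocus {fermatPolynomial ℂ 2 p}) (hhol : HasHolomorphicCoords E ψ)
    (Φ : fermatGroup 2 p → M → M) (hΦd : ∀ a, MDifferentiable 𝓘(ℂ, E) 𝓘(ℂ, E) (Φ a))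
    (hΦψ : ∀ (a : fermatGroup 2 p) (x : M), ψ (Φ a x) =
      Projectivization.mk ℂ ((a : Fin 4 → ℂˣ) • (ψ x).rep)
        ((smul_ne_zero_iff_ne (a : Fin 4 → ℂˣ)).mpr (Projectivization.rep_nonzero _)))
    {η : MForm 𝓘(ℝ, E) M ℂ 2} (hη : IsHolomorphicInCharts η) {β : Fin 4 → ZMod p}
    (heig : ∀ a : fermatGroup 2 p, η.pullback 𝓘(ℝ, E) (Φ a) = ((fermatCharacter p β a : ℂˣ) : ℂ) • η)
    (hβ : ∀ i₀ : Fin 4, p - 4 < ∑ l : Fin 3, ((β (i₀.succAbove l) - 1 : ZMod p)).val) :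
    η = 0 := by
  classical
  haveI : Fact (1 < p) := ⟨by omega⟩
  set F : MvPolynomial (Fin 4) ℂ := fermatPolynomial ℂ 2 p with hFdef
  have hF : F.IsHomogeneous p := isHomogeneous_fermatPolynomial 2 p
  have hJ : SmoothHypersurface.IsNonsingularForm ℂ F :=
    SmoothHypersurface.isNonsingularForm_sum_X_pow (by exact_mod_cast (show p ≠ 0 by omega))
  have hjac : ∀ z : Fin 4 → ℂ, z ≠ 0 → MvPolynomial.eval z F = 0 →
      ∃ j, MvPolynomial.eval z (MvPolynomial.pderiv j F) ≠ 0 := fun z hz hFz ↦ hJ.exists_eval_pderiv_ne_zero hz hFz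
  have hψc : Continuous ψ := hψ.continuous
  have hd : 2 + 2 ≤ p := hp
  have hp1 : 1 ≤ p := by omega
  -- it suffices to treat each chart domain `M_{i₀}`
  suffices h : ∀ i₀ : Fin 4, ∀ x ∈ liftDomain ψ i₀, η x = 0 by
    funext x
    obtain ⟨i₀, hx⟩ := exists_mem_liftDomain ψ x
    exact h i₀ x hx
  intro i₀
  set k : ℕ := p - (2 + 2) with hk
  -- the frame `ρ = ψ^* Res(x_{i₀}^k Ω/F)` on `M_{i₀}`
  set ρ : MForm 𝓘(ℝ, E) M ℂ 2 := residueForm (E := E) ψ F (MvPolynomial.X i₀ ^ k) with hρ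
  have hPhom : (MvPolynomial.X i₀ ^ k : MvPolynomial (Fin 4) ℂ).IsHomogeneous (p - (2 + 2)) := by
    simpa using (MvPolynomial.isHomogeneous_X ℂ i₀).pow k
  have hρhol : IsHolomorphicInCharts ρ := isHolomorphicInCharts_residueForm ψ hF hψc hrange.le hjac hhol hPhom hd
  have hρne : ∀ x ∈ liftDomain ψ i₀, ρ x ≠ 0 := fun x hx ↦
    residueForm_ne_zero ψ hF hψ hrange.le hjac hhol hdim hd hx
  set b : Module.Basis (Fin 2) ℂ E := Module.finBasisOfFinrankEq ℂ E hdim with hb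
  have hρb : ∀ x ∈ liftDomain ψ i₀, (ρ x : E [⋀^Fin 2]→L[ℝ] ℂ) b ≠ 0 := fun x hx ↦
    hρhol.apply_basis_ne_zero b (hρne x hx)
  -- the ratio `f = η(b)/ρ(b)`
  set f : M → ℂ := fun x ↦ (η x : E [⋀^Fin 2]→L[ℝ] ℂ) b / (ρ x : E [⋀^Fin 2]→L[ℝ] ℂ) b with hf
  have hηf : ∀ x ∈ liftDomain ψ i₀, η x = f x • ρ x := by
    intro x hx
    obtain ⟨a, ha⟩ := hρhol.exists_apply_eq_restrictScalars x
    exact topForm_eq_ratio_smul hη.isOfType b ha (hρb x hx)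
  have hfd : ∀ x ∈ liftDomain ψ i₀, MDifferentiableAt 𝓘(ℂ, E) 𝓘(ℂ, ℂ) f x := fun x hx ↦
    mdifferentiableAt_topFormRatio_of_isHolomorphicInCharts hdim hη hρhol b.linearIndependent
      (by filter_upwards [(isOpen_liftDomain ψ hψc i₀).mem_nhds hx] with y hy using hρb y hy)
  -- equivariance of `f`
  have hfeq : ∀ (a : fermatGroup 2 p), ∀ x ∈ liftDomain ψ i₀,
      f (Φ a x) * ((∏ i, (((a : Fin 4 → ℂˣ) i : ℂˣ) : ℂ)) * ((((a : Fin 4 → ℂˣ) i₀ : ℂˣ) : ℂ)) ^ k) =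
        ((fermatCharacter p β a : ℂˣ) : ℂ) * f x := by
    intro a x hx
    have hFa : ∀ z, MvPolynomial.eval ((a : Fin 4 → ℂˣ) • z) F = MvPolynomial.eval z F :=
      eval_smul_of_mem_diagonalStabilizer (fermatGroup_le_diagonalStabilizer p a.2)
    have hPQ : ∀ z : Fin 4 → ℂ,
        MvPolynomial.eval z (((((a : Fin 4 → ℂˣ) i₀ : ℂˣ) : ℂ)) ^ k • (MvPolynomial.X i₀ ^ k : MvPolynomial (Fin 4) ℂ)) =
          MvPolynomial.eval ((a : Fin 4 → ℂˣ) • z) (MvPolynomial.X i₀ ^ k) := by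
      intro z
      simp only [MvPolynomial.smul_eval, map_pow, MvPolynomial.eval_X, Pi.smul_apply', Units.smul_def, smul_eq_mul,
        mul_pow]
    have hpull := pullback_residueForm_symm (hΦψ a) hF hd hψc hrange.le hjac hhol (hΦd a) hFa hPhom hPQ
    rw [residueForm_smul, smul_smul] at hpull
    exact ratio_symm (Φ := Φ a) (S := liftDomain ψ i₀) (fun y hy ↦ mem_liftDomain_symm (hΦψ a) hy) hηf hρne
      (fun y _ ↦ by rw [heig a]; rfl) (fun y _ ↦ by rw [hpull]; rfl) hx
  -- transport to the affine coordinates `u_{i₀}`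
  set U : Set M := liftDomain ψ i₀ with hU
  set aff : M → (Fin 3 → ℂ) := affineCoord ψ i₀ with haff
  have hinj : InjOn aff U := injOn_affineCoord ψ hψ.injective i₀
  set g : (Fin 3 → ℂ) → ℂ := Function.extend (U.restrict aff) (f ∘ Subtype.val) 0 with hg
  have hgaff : ∀ x ∈ U, g (aff x) = f x := by
    intro x hx
    have hinj' : Injective (U.restrict aff) := Set.injOn_iff_injective.1 hinj
    exact hinj'.extend_apply _ _ ⟨x, hx⟩
  -- the image is the affine Fermat surface
  have hS : ∀ z : Fin 3 → ℂ, ∑ l, z l ^ p = -1 ↔ z ∈ aff '' U := by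
    intro z
    rw [haff, hU, affineCoord_image_liftDomain ψ hF hrange i₀, mem_setOf_eq, hFdef, eval_fermatPolynomial,
      Fin.sum_univ_succAbove _ i₀, Fin.insertNth_apply_same, one_pow]
    simp only [Fin.insertNth_apply_succAbove]
    constructor <;> intro h <;> linear_combination h
  -- (hhol) `g` is locally the restriction of holomorphic functions of `ℂ³`
  have hg_hol : ∀ z : Fin 3 → ℂ, ∑ i, z i ^ p = -1 → ∃ W : Set (Fin 3 → ℂ), IsOpen W ∧ z ∈ W ∧
      ∃ G : (Fin 3 → ℂ) → ℂ, DifferentiableOn ℂ G W ∧ ∀ y ∈ W, ∑ i, y i ^ p = -1 → G y = g y := by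
    intro z hz
    obtain ⟨W, hWo, hzW, G, hG, hGg⟩ :=
      exists_differentiableOn_eqOn_image_affineCoord ψ hF hψ hrange.le hjac hhol hdim hfd hgaff ((hS z).1 hz)
    exact ⟨W, hWo, hzW, G, hG, fun y hy hy' ↦ hGg y hy ((hS y).1 hy')⟩
  -- (heig) `g` is a `μ_p³`-eigenfunction with exponents `c_l = ⟨β_l - 1⟩`
  set c : Fin 3 → ℕ := fun l ↦ ((β (i₀.succAbove l) - 1 : ZMod p)).val with hc
  have hcp : ∀ l, c l < p := fun l ↦ ZMod.val_lt _
  have hg_eig : ∀ z : Fin 3 → ℂ, ∑ i, z i ^ p = -1 → ∀ ζ : Fin 3 → ℂ, (∀ i, ζ i ^ p = 1) →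
      g (fun i ↦ ζ i * z i) = (∏ i, ζ i ^ c i) * g z := by
    intro z hz ζ hζ
    obtain ⟨x, hx, rfl⟩ := (hS z).1 hz
    have hζne : ∀ i, ζ i ≠ 0 := fun i h0 ↦ by
      have := hζ i
      rw [h0, zero_pow (by omega)] at this
      exact zero_ne_one this
    -- the group element `a = (ζ with 1 inserted in slot i₀)`
    set au : Fin 4 → ℂˣ := Fin.insertNth i₀ (1 : ℂˣ) (fun l ↦ Units.mk0 (ζ l) (hζne l)) with hau
    have hau_same : au i₀ = 1 := by simp [hau]
    have hau_succ : ∀ l, au (i₀.succAbove l) = Units.mk0 (ζ l) (hζne l) := by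
      intro l; simp [hau]
    have hau_mem : au ∈ fermatGroup 2 p := by
      rw [mem_fermatGroup_iff]
      intro j
      refine Fin.succAboveCases i₀ ?_ (fun l ↦ ?_) j
      · rw [hau_same, one_pow]
      · rw [hau_succ]; ext; simp [hζ l]
    set a : fermatGroup 2 p := ⟨au, hau_mem⟩ with ha
    have hΦx : Φ a x ∈ U := mem_liftDomain_symm (hΦψ a) hx
    have haffΦ : aff (Φ a x) = fun l ↦ ζ l * aff x l := by
      have h2 := (projLift_symm (hΦψ a) hx).2
      funext l
      have hl := congrFun h2 (i₀.succAbove l)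
      rw [Pi.mul_apply, projLift_apply_succAbove, projLift_apply_succAbove] at hl
      rw [haff, hl]
      change ((au (i₀.succAbove l) : ℂ) / (au i₀ : ℂ)) * affineCoord ψ i₀ x l = _
      rw [hau_succ, hau_same]
      simp
    rw [← haffΦ, hgaff _ hΦx, hgaff _ hx]
    have key := hfeq a x hx
    have hprod : (∏ i, (((a : Fin 4 → ℂˣ) i : ℂˣ) : ℂ)) = ∏ l, ζ l := by
      change (∏ i, ((au i : ℂˣ) : ℂ)) = _
      rw [Fin.prod_univ_succAbove _ i₀, hau_same]
      simp [hau_succ]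
    have hai₀ : ((((a : Fin 4 → ℂˣ) i₀ : ℂˣ) : ℂ)) = 1 := by
      change ((au i₀ : ℂˣ) : ℂ) = 1
      rw [hau_same]; rfl
    have hchar : ((fermatCharacter p β a : ℂˣ) : ℂ) = ∏ l, ζ l ^ (β (i₀.succAbove l)).val := by
      rw [fermatCharacter_apply]
      push_cast
      change (∏ i, ((au i : ℂˣ) : ℂ) ^ (β i).val) = _
      rw [Fin.prod_univ_succAbove _ i₀, hau_same]
      simp [hau_succ]
    rw [hprod, hai₀, one_pow, mul_one, hchar] at key
    have hζc : ∀ l, ζ l ^ (β (i₀.succAbove l)).val = ζ l ^ c l * ζ l := fun l ↦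
      pow_val_eq_pow_val_sub_one_mul (hζ l) _
    simp only [hζc, Finset.prod_mul_distrib] at key
    have hζprod : (∏ l, ζ l) ≠ 0 := Finset.prod_ne_zero_iff.2 fun l _ ↦ hζne l
    apply mul_right_cancel₀ hζprod
    rw [key]
    ring
  -- (hgr) polynomial growth
  obtain ⟨C, hC⟩ := exists_bound_topFormRatio ψ hF hψ hrange.le hjac hhol hdim hd hη b i₀
  have hg_gr : ∀ z : Fin 3 → ℂ, ∑ i, z i ^ p = -1 → ‖g z‖ ≤ C * (1 + ‖z‖) ^ k := by
    intro z hz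
    obtain ⟨x, hx, rfl⟩ := (hS z).1 hz
    rw [hgaff x hx]
    exact hC x hx
  -- the weight condition
  have hm : k < ∑ l, c l := by
    have := hβ i₀
    simp only [hk, hc]
    omega
  have hzero := eqOn_zero_of_eigenfunction_of_growth hp1 hg_hol c hcp hg_eig hg_gr hm
  intro x hx
  have hfx : f x = 0 := by
    rw [← hgaff x hx]
    exact hzero _ ((hS _).2 ⟨x, hx, rfl⟩)
  rw [hηf x hx, hfx, zero_smul]

end Model

/-! ### Hodge-model level -/

/-- **Smooth closed `(2,0)`-eigenforms of weight-`≥ 2` characters vanish on every Hodge model of the Fermat surface `X²_p`**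
(`p ≥ 4`): for a Hodge model `A` of `X²_p`, a smooth closed `2`-form `η` of type `(2,0)` on `A.carrier` with
`(g_a^an)^* η = χ_β(a) η` for all `a ∈ μ_p⁴` (`g_a^an = HodgeModel.anMap A A (diagonalAut _ _)`, holomorphic by Serre GAGA §2 n°5),
and `β` with `p - 4 < Σ_{l ≠ i₀} ⟨β_l - 1⟩` for every `i₀`: `η = 0`. The carrier is a compact complex surface embedded onto `V(F)`
with holomorphic affine coordinates (`hypersurface_hodgeModel_coords`), `η` is holomorphic in charts
(`isHolomorphicInCharts_of_isClosedForm_of_isOfType_top`), and `eq_zero_of_fermat_eigenform` applies. This is hypothesis `hforms` of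
the tree's `fermatEigenspace_twoZero_eq_zero_of_eigenforms`. [cite: Shioda1979HodgeFermat, §1 (1.7)] [cite: SerreGAGA1956, §2 n°5] -/
theorem fermat_eigenform_twoZero_eq_zero {p : ℕ} (hp : 4 ≤ p) (A : HodgeModel 2 (fermatHypersurface 2 p))
    {β : Fin 4 → ZMod p} (hβ : ∀ i₀ : Fin 4, p - 4 < ∑ l : Fin 3, ((β (i₀.succAbove l) - 1 : ZMod p)).val)
    {η : MForm 𝓘(ℝ, A.model) A.carrier ℂ 2} (hs : IsSmoothForm η) (hc : IsClosedForm η) (ht : IsOfType 2 0 η)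
    (heig : ∀ a : fermatGroup 2 p, η.pullback 𝓘(ℝ, A.model)
      (HodgeModel.anMap A A (diagonalAut (fermatPolynomial ℂ 2 p) (fermatGroup_le_diagonalStabilizer p a.2))) =
        ((fermatCharacter p β a : ℂˣ) : ℂ) • η) :
    η = 0 := by
  have hX : IsSmoothProjective 2 (fermatHypersurface 2 p) := isSmoothProjective_fermatHypersurface (by norm_num) (by omega)
  set F : MvPolynomial (Fin 4) ℂ := fermatPolynomial ℂ 2 p with hFdef
  have hF : F.IsHomogeneous p := isHomogeneous_fermatPolynomial 2 p
  have hJ : SmoothHypersurface.IsNonsingularForm ℂ F :=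
    SmoothHypersurface.isNonsingularForm_sum_X_pow (by exact_mod_cast (show p ≠ 0 by omega))
  obtain ⟨hψemb, hψrange, hhol, -⟩ := hypersurface_hodgeModel_coords hF hJ A
  haveI : CompactSpace A.carrier := A.compactSpace_carrier hX
  set ψ : A.carrier → ℙ ℂ (Fin 4 → ℂ) :=
    hypersurfacePoint (SmoothHypersurface.hypersurfaceι F) ∘ A.toComplexPoints with hψ
  set Φ : fermatGroup 2 p → A.carrier → A.carrier := fun a ↦
    HodgeModel.anMap A A (diagonalAut F (fermatGroup_le_diagonalStabilizer p a.2)) with hΦ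
  have hΦd : ∀ a, MDifferentiable 𝓘(ℂ, A.model) 𝓘(ℂ, A.model) (Φ a) := fun a ↦
    HodgeModel.mdifferentiable_anMap A A _ hX hX
  have hΦψ : ∀ (a : fermatGroup 2 p) (x : A.carrier), ψ (Φ a x) =
      Projectivization.mk ℂ ((a : Fin 4 → ℂˣ) • (ψ x).rep)
        ((smul_ne_zero_iff_ne (a : Fin 4 → ℂˣ)).mpr (Projectivization.rep_nonzero _)) := by
    intro a x
    simp only [hψ, hΦ, Function.comp_apply, HodgeModel.toComplexPoints_anMap]
    rw [← diagonalMap_apply]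
    exact hypersurfacePoint_diagonalMap F _ _
  have hη : IsHolomorphicInCharts η :=
    isHolomorphicInCharts_of_isClosedForm_of_isOfType_top A.finrank_model hs hc ht
  exact eq_zero_of_fermat_eigenform A.finrank_model hp hψemb hψrange hhol Φ hΦd hΦψ hη heig hβ

/-! ### Class level -/

/-- **`V(β) ∩ H^{2,0}(X²_p) = 0` for characters of weight ≥ 2** (`p ≥ 4`): if `p - 4 < Σ_{l ≠ i₀} ⟨β_l - 1⟩` for every `i₀`, every
class of the eigenspace `V(β) ⊆ H²(X²_p(ℂ); ℂ)` of Hodge type `(2,0)` vanishes (`fermatEigenspace_twoZero_eq_zero_of_eigenforms` fed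
with `fermat_eigenform_twoZero_eq_zero`; a Hodge model `A` is supplied by the caller). In print (Shioda (1.7)): `H^{2,0}(X²_p) ∩ V(β)
= ℂ · Res(x^{b-1}Ω/F)` is non-zero only for `1 ≤ bᵢ`, `Σ bᵢ = p`. [cite: Shioda1979HodgeFermat, §1 (1.7)] [cite: Ran1980, §1 Prop. 1.7 (ii)] -/
theorem fermatEigenspace_twoZero_eq_zero {p : ℕ} (hp : 4 ≤ p) (A : HodgeModel 2 (fermatHypersurface 2 p))
    {β : Fin 4 → ZMod p} (hβ : ∀ i₀ : Fin 4, p - 4 < ∑ l : Fin 3, ((β (i₀.succAbove l) - 1 : ZMod p)).val)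
    {x : complexBetti (fermatHypersurface 2 p) 2} (hx : x ∈ fermatEigenspace p β 2)
    (hxA : IsOfHodgeType 2 (fermatHypersurface 2 p) 2 2 0 x) : x = 0 := by
  haveI : NeZero p := ⟨by omega⟩
  exact fermatEigenspace_twoZero_eq_zero_of_eigenforms A
    (fun η hs hc ht heig ↦ fermat_eigenform_twoZero_eq_zero hp A hβ hs hc ht heig) hx hxA

/-- **Admissible characters of level ≥ 2 carry no `(2,0)`-classes**: for `p ≥ 4`, `β` with all `βᵢ ≠ 0` and `Σ ⟨βᵢ⟩ ≥ 2p`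
(level `|β| ≥ 2`), `V(β) ∩ H^{2,0}(X²_p) = 0`. (For `l ≠ i₀`: `Σ ⟨β_l - 1⟩ = Σ ⟨β_l⟩ - 3 ≥ 2p - (p - 1) - 3 = p - 2 > p - 4`.)
[cite: Shioda1979HodgeFermat, §1 (1.7)] -/
theorem fermatEigenspace_twoZero_eq_zero_of_two_le_level {p : ℕ} (hp : 4 ≤ p) (A : HodgeModel 2 (fermatHypersurface 2 p))
    {β : Fin 4 → ZMod p} (hβ0 : ∀ i, β i ≠ 0) (hβ2 : 2 * p ≤ ∑ i, (β i).val)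
    {x : complexBetti (fermatHypersurface 2 p) 2} (hx : x ∈ fermatEigenspace p β 2)
    (hxA : IsOfHodgeType 2 (fermatHypersurface 2 p) 2 2 0 x) : x = 0 := by
  haveI : NeZero p := ⟨by omega⟩
  haveI : Fact (1 < p) := ⟨by omega⟩
  refine fermatEigenspace_twoZero_eq_zero hp A (fun i₀ ↦ ?_) hx hxA
  have hpos : ∀ i, 1 ≤ (β i).val := fun i ↦ Nat.one_le_iff_ne_zero.2 fun h ↦ hβ0 i ((ZMod.val_eq_zero _).1 h)
  have hval : ∀ i, (β i - 1).val = (β i).val - 1 := by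
    intro i
    have h1 : (1 : ZMod p).val ≤ (β i).val := by rw [ZMod.val_one]; exact hpos i
    rw [ZMod.val_sub h1, ZMod.val_one]
  have hlt : (β i₀).val < p := ZMod.val_lt _
  rw [Fin.sum_univ_succAbove _ i₀] at hβ2
  have h0 := hpos (i₀.succAbove 0)
  have h1 := hpos (i₀.succAbove 1)
  have h2 := hpos (i₀.succAbove 2)
  simp only [hval]
  simp only [Fin.sum_univ_three] at hβ2 ⊢
  omega

/-- **Characters with `Σ βᵢ = 0` and a zero component carry no `(2,0)`-classes** (`p ≥ 4`): e.g. `β = 0`, whose eigenspace is the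
line of the hyperplane class. (For `l ≠ i₀`: a zero component `β_l = 0` contributes `⟨0 - 1⟩ = p - 1 > p - 4`; if the only zero
component is `β_{i₀}`, the other three are non-zero with `Σ_{l ≠ i₀} β_l = 0`, so `Σ ⟨β_l⟩ ∈ {p, 2p}` and `Σ ⟨β_l - 1⟩ ≥ p - 3`.)
[cite: Shioda1979HodgeFermat, §1 (1.7)] [cite: Shioda1979PJA, §1 eq. (3)] -/
theorem fermatEigenspace_twoZero_eq_zero_of_exists_eq_zero {p : ℕ} (hp : 4 ≤ p) (A : HodgeModel 2 (fermatHypersurface 2 p))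
    {β : Fin 4 → ZMod p} (hβs : ∑ i, β i = 0) (hβ0 : ∃ i, β i = 0)
    {x : complexBetti (fermatHypersurface 2 p) 2} (hx : x ∈ fermatEigenspace p β 2)
    (hxA : IsOfHodgeType 2 (fermatHypersurface 2 p) 2 2 0 x) : x = 0 := by
  haveI : NeZero p := ⟨by omega⟩
  haveI : Fact (1 < p) := ⟨by omega⟩
  refine fermatEigenspace_twoZero_eq_zero hp A (fun i₀ ↦ ?_) hx hxA
  have hvz : ((0 : ZMod p) - 1).val = p - 1 := by
    rw [zero_sub, ZMod.neg_val, if_neg one_ne_zero, ZMod.val_one]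
  by_cases hl : ∃ l : Fin 3, β (i₀.succAbove l) = 0
  · obtain ⟨l, hl⟩ := hl
    have hle : (β (i₀.succAbove l) - 1).val ≤ ∑ l' : Fin 3, (β (i₀.succAbove l') - 1).val :=
      Finset.single_le_sum (f := fun l' : Fin 3 ↦ (β (i₀.succAbove l') - 1).val) (by intro l' _; exact Nat.zero_le _)
        (Finset.mem_univ l)
    rw [hl, hvz] at hle
    omega
  · push Not at hl
    -- then `β i₀ = 0` and the other three are non-zero with sum `0`
    obtain ⟨i, hi⟩ := hβ0
    have hi0 : β i₀ = 0 := by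
      rcases Fin.eq_self_or_eq_succAbove i₀ i with rfl | ⟨l, rfl⟩
      · exact hi
      · exact absurd hi (hl l)
    have hsum3 : ∑ l : Fin 3, β (i₀.succAbove l) = 0 := by
      rw [Fin.sum_univ_succAbove _ i₀, hi0, zero_add] at hβs
      exact hβs
    -- `p ∣ Σ ⟨β_l⟩` and it is positive
    have hdvd : p ∣ ∑ l : Fin 3, (β (i₀.succAbove l)).val := by
      rw [← ZMod.natCast_eq_zero_iff, Nat.cast_sum]
      simpa [ZMod.natCast_zmod_val] using hsum3
    have hpos : ∀ l : Fin 3, 1 ≤ (β (i₀.succAbove l)).val := fun l ↦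
      Nat.one_le_iff_ne_zero.2 fun h ↦ hl l ((ZMod.val_eq_zero _).1 h)
    have hval : ∀ l : Fin 3, (β (i₀.succAbove l) - 1).val = (β (i₀.succAbove l)).val - 1 := by
      intro l
      have h1 : (1 : ZMod p).val ≤ (β (i₀.succAbove l)).val := by rw [ZMod.val_one]; exact hpos l
      rw [ZMod.val_sub h1, ZMod.val_one]
    have h0 := hpos 0
    have h1 := hpos 1
    have h2 := hpos 2
    obtain ⟨q, hq⟩ := hdvd
    simp only [hval]
    simp only [Fin.sum_univ_three] at hq ⊢
    have hq1 : 1 ≤ q := by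
      by_contra hq0
      push Not at hq0
      interval_cases q
      omega
    have hle : p ≤ p * q := Nat.le_mul_of_pos_right p hq1
    rw [← hq] at hle
    omega

end Summit.HodgeConjecture.HodgeConjecture.Theorems.CyclicUnitaryPowersFermatEigenformVanishing

end
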